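import Summits.QuantumFields.BalabanUV.T4Continuum.Support.NE3TangentFlatPush
import Summits.QuantumFields.BalabanUV.T4Continuum.Support.NE3HessShapes
import Literature.MathematicalPhysics.QuantumFieldTheory.Balaban1983to89.B4Block227
import HarnessLib

/-!
# T⁴ programme, node NE3, row NE3-R2 (gen 5) — preparation for the coercivity-scaling certificate (`NE3CoercivityScalingPrep`):
# the Wilson Hessian of abelian direction fields at the flat configuration, the zero-mean sawtooth, period-box bookkeeping

Cell `pub-balaban`, unit `b2b-balaban-t4-ne3r2-p1` (OWNER of `BINDER-OWNERS.md` row NE3-R2), gen 5; file 2 of 3 of the kernel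
certificate of GAPS G-ne7king10-1 (file 1 `NE3TangentFlatPush`, file 3 `NE3CoercivityScaling`).  All [folklore], 0 sorry:
§1 at the flat configuration `flatCfg ≡ 1`, for «abelian» direction fields `X = f·E` (real profile `f`, one matrix `E`): the
dressed curl is the plain lattice curl of the profile (`curlAt_flatCfg_prof`), the commutator part of the Hessian density
vanishes (`dcurlAt_flatCfg_prof`), and for `E = i·1` (`iOne`: unit norm, skew, square `−1`) the Wilson Hessian IS the curl
energy — **`hessPlaqAt_flatCfg_iWave`**, **`hess_flatCfg_iWave`**: `hess 1 X X (plaqsOf F) = curlSq 1 X F` (tree `NE3HessForm.hess`,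
`NE3HessShapes.plaqsOf`, normalised trace `nReTr 1 = 1`); §2 the zero-mean SAWTOOTH profile `saw m t = (t mod m) − (m−1)/2`
of period `m` and its three sums `Σ_{t<m} saw = 0`, `Σ_{t<m} saw² = m(m²−1)/12`, `Σ_{t<m} (saw(t+1) − saw t)² = m(m−1)` — the
discrete Poincaré scaling `Σ(Δs)²/Σs² = 12/(m+1)`; §3 sums over the period box `[0,P)^d` of functions of one coordinate
(`sum_periodBox_apply`, via `NE3TangentFlatPush.sum_fun_apply_eq`) and of periodic functions over `N` periods
(`sum_range_mul_of_periodic`).  Reused BY NAME: `B4Block227.sum_range_id_real`, `NE3HessBounds.nReTr_neg'`.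

HONEST FRAMING.  Elementary finite-`T⁴` identities at ONE (flat) configuration; rung (B)+1; nothing of Bałaban's is asserted;
NE3 NOT proved; NOT infinite volume, NOT mass gap, NOT Clay, NOT summit progress.  ABSOLUTE RULE kept: no printed sentence is a
hypothesis.  PLACEMENT: our work, under `Summits/QuantumFields/BalabanUV/`; imports accepted tree modules only; moves nothing.
Record: HOME `t4/T4-EST-NE3-R2.md` v0.6.
-/

set_option autoImplicit false

open scoped BigOperators Matrix Matrix.Norms.L2Operator
open NormedSpace Finset

namespace Summit.QuantumFields.BalabanUV.T4Continuum.NE3CoercivityScalingPrep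

open Literature.MathematicalPhysics.QuantumFieldTheory.Balaban1983to89
open B7Prop1Explicit B7Prop2Explicit MatrixLog UnitaryModel MatrixNorms
open T4AveragingDeficitWall hiding Site Plane Plaq Bond
open T4AveragingDeficitWallBoundary (periodBox)
open AveragingDeficitPeriodicCounting (IsPeriodicDir)
open AveragingDeficitMultiLevelPrep (TangentIter)
open MinimalActionWitness (flatCfg)
open NE3HessForm (hess hessPlaq hessPlaqAt dcurlAt)
open NE3HessShapes (TangentCoercive plaqsOf sum_plaqsOf)
open NE3HessBounds (nReTr_neg')
open NE3TangentFlatPush (slabWave shift_mul_period isPeriodicDir_slabWave sum_fun_apply_eq tangentIter_flatCfg_slabWave)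

noncomputable section

variable {d : ℕ} {n : Type*} [Fintype n] [DecidableEq n]

/-! ## §1 The Wilson Hessian of abelian direction fields at the flat configuration -/

/-- `flatCfg x μ = 1`. [folklore] -/
theorem flatCfg_apply (x : Site d) (μ : Fin d) : (flatCfg (d := d) (n := n)) x μ = 1 := rfl

/-- `Ad_1 = id`. [folklore] -/
theorem Ad_one (X : Matrix n n ℂ) : Ad (1 : (Matrix n n ℂ)ˣ) X = X := by simp [Ad]

/-- Real multiples of one matrix commute. [folklore] -/
theorem smul_mul_smul_comm' (E : Matrix n n ℂ) (a b : ℝ) : (a • E) * (b • E) = (b • E) * (a • E) := by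
  rw [smul_mul_assoc, mul_smul_comm, smul_mul_assoc, mul_smul_comm, smul_smul, smul_smul, mul_comm]

/-- At the flat configuration the dressed curl of `f·E` is the plain lattice curl of the profile times `E`. [folklore] -/
theorem curlAt_flatCfg_prof (f : Site d → Fin d → ℝ) (E : Matrix n n ℂ) (z : Site d) (μ ν : Fin d) :
    curlAt (flatCfg (d := d) (n := n)) (fun x κ => f x κ • E) z μ ν
      = (f z μ + f (z + e μ) ν - f (z + e ν) μ - f z ν) • E := by
  simp only [curlAt, flatCfg_apply, mul_one, inv_one, Ad_one, add_smul, sub_smul]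

/-- At the flat configuration the commutator part of the Hessian density of an abelian field vanishes. [folklore] -/
theorem dcurlAt_flatCfg_prof (f : Site d → Fin d → ℝ) (E : Matrix n n ℂ) (z : Site d) (μ ν : Fin d) :
    dcurlAt (flatCfg (d := d) (n := n)) (fun x κ => f x κ • E) (fun x κ => f x κ • E) z μ ν = 0 := by
  have hc := smul_mul_smul_comm' E
  simp only [dcurlAt, flatCfg_apply, mul_one, inv_one, Ad_one, sub_mul, mul_sub, hc (f (z + e μ) ν) (f z μ),
    hc (f (z + e ν) μ) (f z μ), hc (f z ν) (f z μ), hc (f (z + e ν) μ) (f (z + e μ) ν), hc (f z ν) (f (z + e μ) ν),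
    hc (f z ν) (f (z + e ν) μ), sub_self, add_zero]

/-- The witness matrix `i·1`. [folklore] -/
def iOne : Matrix n n ℂ := Complex.I • (1 : Matrix n n ℂ)

/-- `(i·1)² = −1`. [folklore] -/
theorem iOne_mul_iOne : (iOne : Matrix n n ℂ) * iOne = -1 := by
  simp [iOne, smul_smul, Complex.I_mul_I]

/-- `‖i·1‖ = 1`. [folklore] -/
theorem norm_iOne [Nonempty n] : ‖(iOne : Matrix n n ℂ)‖ = 1 := by
  rw [iOne, norm_smul, Complex.norm_I, norm_one, mul_one]

/-- `i·1 ∈ 𝔲(N)`. [folklore] -/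
theorem iOne_mem_skew : (iOne : Matrix n n ℂ) ∈ skewAdjoint (Matrix n n ℂ) := by
  rw [skewAdjoint.mem_iff, iOne, star_smul, star_one, Complex.star_def, Complex.conj_I, neg_smul]

omit [DecidableEq n] in
/-- `Re tr (c • M) = c · Re tr M` for real `c`. [folklore] -/
theorem nReTr_real_smul (c : ℝ) (M : Matrix n n ℂ) : nReTr (c • M) = c * nReTr M := by
  simp only [nReTr, Matrix.trace_smul, Complex.smul_re, smul_eq_mul]
  ring

/-- **AT THE FLAT CONFIGURATION THE WILSON HESSIAN OF `f·(i·1)` IS ITS CURL ENERGY**, plaquette by plaquette. [folklore] -/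
theorem hessPlaqAt_flatCfg_iWave [Nonempty n] (f : Site d → Fin d → ℝ) (z : Site d) (μ ν : Fin d) :
    hessPlaqAt (flatCfg (d := d) (n := n)) (fun x κ => f x κ • iOne) (fun x κ => f x κ • iOne) z μ ν
      = ‖curlAt (flatCfg (d := d) (n := n)) (fun x κ => f x κ • iOne) z μ ν‖ ^ 2 := by
  rw [hessPlaqAt, dcurlAt_flatCfg_prof, zero_add, curlAt_flatCfg_prof]
  have hhol : ((hol (flatCfg (d := d) (n := n)) z (plaqWord μ ν) : (Matrix n n ℂ)ˣ) : Matrix n n ℂ) = 1 := by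
    rw [show (flatCfg (d := d) (n := n)) = fun _ _ => 1 from rfl, hol_flat, Units.val_one]
  rw [hhol, mul_one, smul_mul_assoc, mul_smul_comm, smul_smul, iOne_mul_iOne, smul_neg, nReTr_neg', nReTr_real_smul,
    nReTr_one, mul_one, neg_neg, norm_smul, norm_iOne, mul_one, Real.norm_eq_abs, sq_abs, sq]

/-- **`hess 1 X X (plaqsOf F) = curlSq 1 X F`** for `X = f·(i·1)`. [folklore] -/
theorem hess_flatCfg_iWave [Nonempty n] (f : Site d → Fin d → ℝ) (F : Finset (Site d)) :
    hess (flatCfg (d := d) (n := n)) (fun x κ => f x κ • iOne) (fun x κ => f x κ • iOne) (plaqsOf F)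
      = curlSq (flatCfg (d := d) (n := n)) (fun x κ => f x κ • iOne) F := by
  rw [hess, sum_plaqsOf, curlSq]
  refine Finset.sum_congr rfl fun z _ => Finset.sum_congr rfl fun π _ => ?_
  exact hessPlaqAt_flatCfg_iWave f z π.1.1 π.1.2

/-! ## §2 The sawtooth profile and its three sums -/

/-- THE ZERO-MEAN SAWTOOTH of period `m`: `saw m t = (t mod m) − (m−1)/2`. [folklore] -/
def saw (m : ℕ) (t : ℤ) : ℝ := ((t % (m : ℤ) : ℤ) : ℝ) - ((m : ℝ) - 1) / 2

/-- The sawtooth is `m`-periodic. [folklore] -/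
theorem saw_periodic (m : ℕ) (t : ℤ) : saw m (t + (m : ℤ)) = saw m t := by
  simp [saw]

/-- On `0 ≤ t < m` the sawtooth is `t − (m−1)/2`. [folklore] -/
theorem saw_natCast {m t : ℕ} (ht : t < m) : saw m (t : ℤ) = (t : ℝ) - ((m : ℝ) - 1) / 2 := by
  rw [saw, Int.emod_eq_of_lt (by positivity) (by exact_mod_cast ht)]
  push_cast
  ring

/-- `Σ_{i<m} i² = m(m−1)(2m−1)/6` over `ℝ`. [folklore] -/
theorem sum_range_cast_sq (m : ℕ) :
    ∑ i ∈ Finset.range m, (i : ℝ) ^ 2 = (m : ℝ) * ((m : ℝ) - 1) * (2 * (m : ℝ) - 1) / 6 := by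
  induction m with
  | zero => simp
  | succ m ih => rw [Finset.sum_range_succ, ih]; push_cast; ring

/-- The sawtooth has zero period sum. [folklore] -/
theorem sum_range_saw (m : ℕ) : ∑ t ∈ Finset.range m, saw m (t : ℤ) = 0 := by
  rw [Finset.sum_congr rfl fun t ht => saw_natCast (Finset.mem_range.mp ht), Finset.sum_sub_distrib, B4Block227.sum_range_id_real,
    Finset.sum_const, Finset.card_range, nsmul_eq_mul]
  ring

/-- `Σ_{t<m} saw² = m(m²−1)/12`. [folklore] -/
theorem sum_range_saw_sq (m : ℕ) :
    ∑ t ∈ Finset.range m, saw m (t : ℤ) ^ 2 = (m : ℝ) * ((m : ℝ) ^ 2 - 1) / 12 := by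
  have h : ∀ t ∈ Finset.range m, saw m (t : ℤ) ^ 2
      = (t : ℝ) ^ 2 - ((m : ℝ) - 1) * (t : ℝ) + (((m : ℝ) - 1) / 2) ^ 2 := by
    intro t ht; rw [saw_natCast (Finset.mem_range.mp ht)]; ring
  rw [Finset.sum_congr rfl h, Finset.sum_add_distrib, Finset.sum_sub_distrib, sum_range_cast_sq, ← Finset.mul_sum,
    B4Block227.sum_range_id_real, Finset.sum_const, Finset.card_range, nsmul_eq_mul]
  ring

/-- `Σ_{t<m} (saw(t+1) − saw t)² = m(m−1)`: unit steps inside the period, one drop of height `m−1`. [folklore] -/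
theorem sum_range_dsaw_sq {m : ℕ} (hm : 1 ≤ m) :
    ∑ t ∈ Finset.range m, (saw m ((t : ℤ) + 1) - saw m (t : ℤ)) ^ 2 = (m : ℝ) * ((m : ℝ) - 1) := by
  obtain ⟨m', rfl⟩ : ∃ m', m = m' + 1 := ⟨m - 1, by omega⟩
  rw [Finset.sum_range_succ]
  have hin : ∀ t ∈ Finset.range m', (saw (m' + 1) ((t : ℤ) + 1) - saw (m' + 1) (t : ℤ)) ^ 2 = 1 := by
    intro t ht
    have ht' := Finset.mem_range.mp ht
    rw [show ((t : ℤ) + 1) = ((t + 1 : ℕ) : ℤ) by push_cast; ring, saw_natCast (by omega), saw_natCast (by omega)]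
    push_cast; ring
  have hlast : saw (m' + 1) ((m' : ℤ) + 1) - saw (m' + 1) (m' : ℤ) = -(m' : ℝ) := by
    rw [show ((m' : ℤ) + 1) = (0 : ℤ) + ((m' + 1 : ℕ) : ℤ) by push_cast; ring, saw_periodic,
      show (0 : ℤ) = ((0 : ℕ) : ℤ) from rfl, saw_natCast (by omega), saw_natCast (by omega)]
    push_cast; ring
  rw [Finset.sum_congr rfl hin, hlast, Finset.sum_const, Finset.card_range, nsmul_eq_mul]
  push_cast; ring

/-! ## §3 Period-box bookkeeping -/

/-- Sums over the period box of a function of one coordinate. [folklore] -/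
theorem sum_periodBox_apply (P : ℕ) (i₁ : Fin d) (g : ℤ → ℝ) :
    ∑ z ∈ periodBox (d := d) P, g (z i₁) = (P : ℝ) ^ (d - 1) * ∑ a ∈ Finset.range P, g (a : ℤ) := by
  unfold periodBox
  have hinj : Function.Injective (boxVec (d := d) P) := fun r r' h =>
    funext fun κ => Fin.ext (by have := congr_fun h κ; simp only [boxVec, Nat.cast_inj] at this; exact this)
  rw [Finset.sum_image fun r _ r' _ h => hinj h]
  have hbox : ∀ r : Fin d → Fin P, g (boxVec P r i₁) = g ((r i₁ : ℕ) : ℤ) := fun r => rfl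
  simp only [hbox]
  rw [sum_fun_apply_eq P i₁ (fun a : Fin P => g ((a : ℕ) : ℤ)), Fin.sum_univ_eq_sum_range (fun a : ℕ => g (a : ℤ)) P]

/-- Sums of an `m`-periodic function over `N` periods. [folklore] -/
theorem sum_range_mul_of_periodic (g : ℤ → ℝ) (m : ℕ) (hg : ∀ t, g (t + (m : ℤ)) = g t) :
    ∀ N : ℕ, ∑ t ∈ Finset.range (N * m), g (t : ℤ) = (N : ℝ) * ∑ t ∈ Finset.range m, g (t : ℤ)
  | 0 => by simp
  | N + 1 => by
      rw [Nat.succ_mul, Finset.sum_range_add, sum_range_mul_of_periodic g m hg N]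
      rw [Nat.cast_succ, add_mul, one_mul]
      congr 1
      refine Finset.sum_congr rfl fun t _ => ?_
      push_cast
      rw [show (N : ℤ) * (m : ℤ) + (t : ℤ) = (t : ℤ) + (N : ℤ) * (m : ℤ) by ring, shift_mul_period hg]

end

end Summit.QuantumFields.BalabanUV.T4Continuum.NE3CoercivityScalingPrep
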